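import Summits.Ventures.PercRepro.Night2OneFatCaseOneSeven

/-!
# PercRepro — two collinear triples of a seven-point one-coloop set are disjoint (night-2, gen 29)

`lines_disjoint_of_one_coloop_seven`: in a seven-point set `V` of rank 5 with a single coloop `w`, two distinct collinear
triples `R₁ ≠ R₂` are disjoint — if they shared a point, `{w} ∪ R₁ ∪ R₂` would have rank at most 4 and a point of `V` off it
would be a second coloop.  Hence the open seven-point case of the column bound is exactly the shape (i) of
proofs/NIGHT-2-g29.md §4 (two disjoint three-point lines), and `dload_gt_le_cap2_of_card_coloops_le_one''` states the
bound with that hypothesis (no two disjoint collinear triples off `K` at a seven-point one-coloop target).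
-/

namespace PercRepro.Shadow

open Finset PerFlat ThmH

variable {α : Type*} [DecidableEq α] {M : Matroid α} [M.Finite] {G : Finset α}

section SevenB

/-- A coloop of `V` lies on no collinear triple of `V`. -/
theorem notMem_line_of_mem_coloops (hs : ∀ e ∈ gr M, ∀ f ∈ gr M, e ≠ f → rkN M {e, f} = 2) {V : Finset α}
    (hVg : V ⊆ gr M) {w : α} (hw : w ∈ coloops M V) {R : Finset α} (hR : R ⊆ V) (h3 : R.card = 3)
    (hr : rkN M R = 2) : w ∉ R := by
  intro hwR
  have hRg : R ⊆ gr M := hR.trans hVg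
  obtain ⟨p, hp, p', hp', hpp'⟩ := Finset.one_lt_card.1 (by rw [Finset.card_erase_of_mem hwR]; omega : 1 < (R.erase w).card)
  have h2 : 2 ≤ rkN M (R.erase w) := rkN_pair_eq_two hs ((Finset.erase_subset _ _).trans hRg) hp hp' hpp'
  have h2' : rkN M (R.erase w) ≤ 2 := by rw [← hr]; exact rkN_mono (Finset.erase_subset _ _)
  have hwcl : w ∈ clF M (R.erase w) := mem_clF_of_rkN_eq (Finset.erase_subset _ _) hRg (by omega) hwR
  exact (mem_coloops.1 hw).2 (clF_mono (Finset.erase_subset_erase _ hR) hwcl)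

/-- **Two distinct collinear triples of a seven-point rank-5 set with a single coloop are disjoint.** -/
theorem lines_disjoint_of_one_coloop_seven (hs : ∀ e ∈ gr M, ∀ f ∈ gr M, e ≠ f → rkN M {e, f} = 2)
    {V : Finset α} (hVg : V ⊆ gr M) (hV5 : rkN M V = 5) (h7 : V.card = 7) {w : α} (hc : coloops M V = {w})
    {R₁ R₂ : Finset α} (hR₁ : R₁ ⊆ V) (hR₂ : R₂ ⊆ V) (h₁ : R₁.card = 3) (h₂ : R₂.card = 3) (hr₁ : rkN M R₁ = 2)
    (hr₂ : rkN M R₂ = 2) (hne : R₁ ≠ R₂) : Disjoint R₁ R₂ := by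
  by_contra hdis
  rw [Finset.not_disjoint_iff] at hdis
  obtain ⟨t, ht₁, ht₂⟩ := hdis
  have hwc : w ∈ coloops M V := by rw [hc]; exact Finset.mem_singleton_self _
  have hwV : w ∈ V := (mem_coloops.1 hwc).1
  have hw₁ : w ∉ R₁ := notMem_line_of_mem_coloops hs hVg hwc hR₁ h₁ hr₁
  have hw₂ : w ∉ R₂ := notMem_line_of_mem_coloops hs hVg hwc hR₂ h₂ hr₂
  have hR₁g : R₁ ⊆ gr M := hR₁.trans hVg
  -- the intersection has rank equal to its cardinality (one or two points)
  have hint : (R₁ ∩ R₂).card ≤ 2 := by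
    by_contra h3
    have hsub : R₁ ∩ R₂ ⊆ R₁ := Finset.inter_subset_left
    have := Finset.eq_of_subset_of_card_le hsub (by omega)
    have hsub' : R₁ ∩ R₂ ⊆ R₂ := Finset.inter_subset_right
    have := Finset.eq_of_subset_of_card_le hsub' (by omega)
    exact hne (by rw [← ‹R₁ ∩ R₂ = R₁›, ‹R₁ ∩ R₂ = R₂›])
  have hint1 : 1 ≤ (R₁ ∩ R₂).card := Finset.card_pos.2 ⟨t, Finset.mem_inter.2 ⟨ht₁, ht₂⟩⟩
  have hrint : rkN M (R₁ ∩ R₂) = (R₁ ∩ R₂).card := by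
    apply le_antisymm (rkN_le_card _)
    rcases (by omega : (R₁ ∩ R₂).card = 1 ∨ (R₁ ∩ R₂).card = 2) with h | h
    · rw [h]
      obtain ⟨p, hp, hpt⟩ : ∃ p ∈ R₁, p ≠ t := by
        by_contra hall
        push Not at hall
        have : R₁ ⊆ {t} := fun a ha => Finset.mem_singleton.2 (hall a ha)
        have := Finset.card_le_card this
        rw [Finset.card_singleton] at this
        omega
      have hpair := hs t (hR₁g ht₁) p (hR₁g hp) hpt.symm
      have hle : rkN M ({t, p} : Finset α) ≤ rkN M {t} + ({p} : Finset α).card := by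
        have h := rkN_inter_add_rkN_union_le (M := M) {t} {p}
        have h' := rkN_le_card (M := M) {p}
        rw [← Finset.insert_eq] at h
        omega
      have hmono : rkN M {t} ≤ rkN M (R₁ ∩ R₂) := rkN_mono (Finset.singleton_subset_iff.2 (Finset.mem_inter.2 ⟨ht₁, ht₂⟩))
      rw [Finset.card_singleton] at hle
      omega
    · rw [h]
      obtain ⟨p, hp, p', hp', hpp'⟩ := Finset.one_lt_card.1 (by omega : 1 < (R₁ ∩ R₂).card)
      exact rkN_pair_eq_two hs (Finset.inter_subset_left.trans hR₁g) hp hp' hpp'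
  -- submodularity: `rk (R₁ ∪ R₂) ≤ 4 − rk (R₁ ∩ R₂)`
  have hsub := rkN_inter_add_rkN_union_le (M := M) R₁ R₂
  rw [hr₁, hr₂, hrint] at hsub
  have hcardU : (R₁ ∪ R₂).card + (R₁ ∩ R₂).card = 6 := by
    have := Finset.card_union_add_card_inter R₁ R₂
    omega
  -- a point `v` of `V` off `{w} ∪ R₁ ∪ R₂`
  have hwU : w ∉ R₁ ∪ R₂ := fun h => (Finset.mem_union.1 h).elim hw₁ hw₂
  have hWsub : insert w (R₁ ∪ R₂) ⊆ V := Finset.insert_subset hwV (Finset.union_subset hR₁ hR₂)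
  have hcardW : (insert w (R₁ ∪ R₂)).card = (R₁ ∪ R₂).card + 1 := Finset.card_insert_of_notMem hwU
  obtain ⟨v, hvV, hvW⟩ : ∃ v ∈ V, v ∉ insert w (R₁ ∪ R₂) := by
    by_contra hall
    push Not at hall
    have := Finset.card_le_card (show V ⊆ insert w (R₁ ∪ R₂) from hall)
    omega
  have hvw : v ≠ w := fun h => hvW (h ▸ Finset.mem_insert_self _ _)
  -- `V ∖ v ⊆ (insert w (R₁ ∪ R₂)) ∪ (V ∖ insert v (insert w (R₁ ∪ R₂)))`, of rank `≤ 1 + rk (R₁ ∪ R₂) + (|∩| − 1) ≤ 4`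
  have hrest : (V \ insert v (insert w (R₁ ∪ R₂))).card = (R₁ ∩ R₂).card - 1 := by
    have hsub' : insert v (insert w (R₁ ∪ R₂)) ⊆ V := Finset.insert_subset hvV hWsub
    have h1 := Finset.card_sdiff_add_card_eq_card hsub'
    rw [Finset.card_insert_of_notMem hvW, hcardW] at h1
    omega
  have hVerase : V.erase v ⊆ insert w (R₁ ∪ R₂) ∪ (V \ insert v (insert w (R₁ ∪ R₂))) := by
    intro a ha
    by_cases haW : a ∈ insert w (R₁ ∪ R₂)
    · exact Finset.mem_union_left _ haW
    · refine Finset.mem_union_right _ (Finset.mem_sdiff.2 ⟨Finset.mem_of_mem_erase ha, ?_⟩)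
      intro h
      rcases Finset.mem_insert.1 h with h | h
      · exact (Finset.mem_erase.1 ha).1 h
      · exact haW h
  have hrk : rkN M (V.erase v) ≤ 4 := by
    have h1 := rkN_mono (M := M) hVerase
    have h2 := rkN_inter_add_rkN_union_le (M := M) (insert w (R₁ ∪ R₂)) (V \ insert v (insert w (R₁ ∪ R₂)))
    have h3 := rkN_le_card (M := M) (V \ insert v (insert w (R₁ ∪ R₂)))
    have h4 := rkN_inter_add_rkN_union_le (M := M) {w} (R₁ ∪ R₂)
    have h5 := rkN_le_card (M := M) {w}
    rw [Finset.card_singleton] at h5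
    rw [← Finset.insert_eq] at h4
    omega
  -- so `v` is a second coloop
  have hvc : v ∈ coloops M V := by
    by_contra hvc
    have := rkN_erase_of_not_coloop hVg hvV hvc
    omega
  rw [hc, Finset.mem_singleton] at hvc
  exact hvw hvc

open scoped Classical in
/-- **A target with at most one coloop whose points off `K` do not have rank 5 has no source** (a lossy erasure has rank 5
off `K`). -/
theorem dload_gt_le_cap2_of_rkN_ne_five (hG : G ∈ flatsQ M (5 + 1)) (hd : (gr M \ G).card = 2)
    (hk : kColoops M G = 1) (hs : ∀ e ∈ gr M, ∀ f ∈ gr M, e ≠ f → rkN M {e, f} = 2)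
    (hl : ∀ e ∈ gr M, M.Indep {e}) {S : Finset α} (hSG : S ⊆ G) (hc1 : (coloops M (S \ coloops M G)).card ≤ 1)
    (h5 : rkN M (S \ coloops M G) ≠ 5) : dload M 5 G (bigP M G) (dshGT M 5 G) S ≤ cap2 M 5 G S := by
  have hd' : (gr M \ G).card ≤ 5 := by omega
  have hcapS := capS_ge_eleven_eighteenths_two_one hd hk hSG
  have hcap2 := cap2_ge_capS_sub_L1_of_le hG hd' S
  have hL1S := L1_le_of_card_coloops_le_one hG hd hc1
  have h1 := dload_gt_le_sum (P := bigP M G) hG hd' S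
  have h2 : ∑ y ∈ S, gtLoadAt M 5 G (bigP M G) (S.erase y) y = 0 := by
    apply Finset.sum_eq_zero
    intro y _
    apply gtLoadAt_eq_zero_of_faceLossP_eq_zero
    intro w' hw'
    by_contra h0
    obtain ⟨-, hQ5, -, -, -, -⟩ := lossy_structure_of_faceLossP_ne_zero hG hd hk hs hl hw' h0
    have hmono : rkN M (S.erase y \ coloops M G) ≤ rkN M (S \ coloops M G) :=
      rkN_mono (Finset.sdiff_subset_sdiff (Finset.erase_subset _ _) (Finset.Subset.refl _))
    have hb : rkN M (S \ coloops M G) ≤ rkN M (G \ coloops M G) :=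
      rkN_mono (Finset.sdiff_subset_sdiff hSG (Finset.Subset.refl _))
    rw [rkN_sdiff_coloops_eq_five hG hk] at hb
    omega
  rw [h2] at h1
  linarith

open scoped Classical in
/-- **The column bound of `dshGT` at every target with at most one coloop**, the one-coloop targets with exactly seven points
off `K` being required to carry no two DISJOINT collinear triples (the open shape (i)). -/
theorem dload_gt_le_cap2_of_card_coloops_le_one'' (hG : G ∈ flatsQ M (5 + 1)) (hd : (gr M \ G).card = 2)
    (hk : kColoops M G = 1) (hs : ∀ e ∈ gr M, ∀ f ∈ gr M, e ≠ f → rkN M {e, f} = 2)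
    (hl : ∀ e ∈ gr M, M.Indep {e}) (hfat : (fatClosures M 5 G 2).card ≤ 1) {S : Finset α} (hSG : S ⊆ G)
    (hKS : coloops M G ⊆ S) (hc1 : (coloops M (S \ coloops M G)).card ≤ 1)
    (h7 : (coloops M (S \ coloops M G)).card = 1 → (S \ coloops M G).card = 7 →
      ∀ R₁ R₂ : Finset α, R₁ ⊆ S \ coloops M G → R₂ ⊆ S \ coloops M G → R₁.card = 3 → R₂.card = 3 →
        rkN M R₁ = 2 → rkN M R₂ = 2 → Disjoint R₁ R₂ → False) :
    dload M 5 G (bigP M G) (dshGT M 5 G) S ≤ cap2 M 5 G S := by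
  by_cases hV5 : rkN M (S \ coloops M G) = 5
  swap
  · exact dload_gt_le_cap2_of_rkN_ne_five hG hd hk hs hl hSG hc1 hV5
  apply dload_gt_le_cap2_of_card_coloops_le_one' hG hd hk hs hl hfat hSG hKS hc1
  intro h1 h7' R₁ R₂ hR₁ hR₂ h₁ h₂ hr₁ hr₂
  by_contra hne
  obtain ⟨w, hw⟩ := Finset.card_eq_one.1 h1
  have hGg : G ⊆ gr M := (mem_flatsQ.1 hG).1
  have hVg : S \ coloops M G ⊆ gr M := Finset.sdiff_subset.trans (hSG.trans hGg)
  have hd := lines_disjoint_of_one_coloop_seven hs hVg hV5 h7' hw hR₁ hR₂ h₁ h₂ hr₁ hr₂ hne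
  exact h7 h1 h7' R₁ R₂ hR₁ hR₂ h₁ h₂ hr₁ hr₂ hd

end SevenB

end PercRepro.Shadow
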